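import Summits.HodgeConjecture.CorCM.CMSixfoldRank.RankAtLeastSix
import Literature.AlgebraicGeometry.Pohlmann1968.SimpleCMFourfoldWeilType
import Literature.AlgebraicGeometry.Pohlmann1968.CorankOneCMTypeWeilType
import HarnessLib

/-!
# Primitive CM types on CM fields of degree `12`: rank `6` or `7` — every simple CM abelian sixfold has corank `≤ 1`;
# a degenerate type is balanced `(3,3)` over an imaginary quadratic subfield `ℚ(√-d)`

Cell `pub-hodgecm2` (COR-CM), count-neutral literature seat `lit-deligne-3` gen 5; KERNEL ONLY (theorems; no
definition, no named fact).  Number-field dress of this directory's `RankAtLeastSix` (NEW WORK, hence under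
`Summits/`), input of `SimpleCMSixfoldNondegenerateHodge.lean` (the closing of the ring-2 atlas cell
`HodgeNondegenerateCMSixfold`).

For a CM field `K` with `[K:ℚ] = 12` and a PRIMITIVE CM type `Φ` (`Pohlmann1968.cmTypeRank`, `IsNondegenerate`):

* §1 `six_le_cmTypeRank`, `cmTypeRank_eq_six_or_eq_seven` — `Rank(Φ) ∈ {6, 7}`;
  `not_isNondegenerate_iff_exists_transversal` — `Φ` is degenerate iff there is a balanced transversal
  `Ψ ⊆ Hom(K, ℂ)` (`|Ψ ∩ {s, s̄}| = 1`, Pohlmann's condition (9.2.1) for `𝟙_Ψ`);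
  **`le_cmTypeRank_of_finrank_eq_twelve`** — `[K:ℚ]/2 ≤ cmTypeRank Φ`: every primitive type of a CM field of degree
  `12` has CORANK `≤ 1`, which is the standing hypothesis `hrank` of EVERY theorem of the tree's
  `Literature/AlgebraicGeometry/Pohlmann1968/CorankOneCMTypeWeilType.lean` (`Pohlmann1968.CorankOne`, lit-pohlmann;
  there recovered on eight embeddings from Ribet's bound, `CorankOne.le_cmTypeRank_of_finrank_eq_eight`) — so that whole
  file applies to every simple complex abelian SIXFOLD of CM type;
* §2 the degree-`12` specialisations of `CorankOne`, `hrank` discharged, BY NAME (no re-derivation):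
  `exists_mem_pohlmannSets_three_diff` (degenerate ⟹ an exceptional balanced `6`-set `Δ ∈ pohlmannSets Φ 3 ∖
  pohlmannDivisorSets Φ 3`: exceptional classes live in `H⁶` of the sixfold), `pohlmannSets_subset_pohlmannDivisorSets_of_ne_three`
  (`Bᵠ = Dᵠ` on index sets for `q ≠ 3`), **`not_isNondegenerate_iff_exists_weilFibre`** (degenerate ⟺ an imaginary
  quadratic subfield `k ⊆ K` over which `Φ` is balanced), `ncard_extensions_mem_eq_three` (balanced over a quadratic
  `k` in degree `12` = multiplicities `(3, 3)`), **`exists_sqrt_neg_of_not_isNondegenerate`** (`k = ℚ(√-d)`,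
  `w = √-d ∈ 𝓞_K`, `d ≥ 1`, `Δ = {s | s(w) = i√d}` and `|Φ ∩ Δ| = 3`).

## References

* [Dodson1987] B. Dodson, J. Algebra 111 (1987), Thm. 1.0, §1.1 (held `paper:doi-10-1016-0021-8693-87-90242-0`
  p0003–p0004).
* [MoonenZarhin1999LowDim] B. Moonen, Yu. Zarhin, Math. Ann. 315 (1999), Thm. 0.1 (1.4), §5.
* [vanGeemen1994HodgeAV] B. van Geemen, LNM 1594 (1994), 4.7, 4.9, Thm. 6.12.
* [Gordon1999HodgeAVSurvey] B. B. Gordon, *A survey of the Hodge conjecture for abelian varieties*, 5.13, §9.2 (9.2.1),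
  9.4 (held `paper:arxiv-alg-geom_9709030` p0017–p0018, p0024).
-/

noncomputable section

open CategoryTheory NumberField
open scoped BigOperators Pointwise Classical

namespace Summit.HodgeConjecture.CorCM.CMSixfoldRank

open Literature.NumberTheory.ComplexMultiplication
open Literature.AlgebraicGeometry Literature.AlgebraicGeometry.Motives
open Literature.AlgebraicGeometry.Pohlmann1968
open Literature.AlgebraicGeometry.Pohlmann1968.CorankOne

/-! ### §1 CM fields of degree `12`: a primitive type has rank `6` or `7` -/

section Rank

variable {K : Type} [Field K] [NumberField K]

/-- `|Hom(K, ℂ)| = [K:ℚ] = 12`. [folklore] -/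
theorem card_embeddings_eq_twelve (hK : Module.finrank ℚ K = 12) : Fintype.card (K →+* ℂ) = 12 := by
  rw [Embeddings.card, hK]

variable [IsCMField K] {Φ : CMType K}

/-- **`Rank(Φ) ≥ 6` for a primitive CM type on a CM field of degree `12`** (number-field dress of
`six_le_typeRank_of_card_eq_twelve`). [cite: Dodson1987, Thm. 1.0 and §1.1] -/
theorem six_le_cmTypeRank (hK : Module.finrank ℚ K = 12) (φ₀ : K →+* ℂ) (hprim : IsPrimitive (ℂ ≃+* ℂ) Φ.1 φ₀) :
    6 ≤ cmTypeRank Φ := by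
  haveI := isPretransitive_ringEquiv_complex (K := K)
  exact six_le_typeRank_of_card_eq_twelve_of_isPrimitive (isCMTypeWith_conj Φ) (card_embeddings_eq_twelve hK)
    hprim

/-- **`Rank(Φ) ∈ {6, 7}`** for a primitive CM type on a CM field of degree `12` (Kubota's `Rank ≤ n + 1` above).
[cite: Dodson1987, Thm. 1.0 (ii)] -/
theorem cmTypeRank_eq_six_or_eq_seven (hK : Module.finrank ℚ K = 12) (φ₀ : K →+* ℂ)
    (hprim : IsPrimitive (ℂ ≃+* ℂ) Φ.1 φ₀) : cmTypeRank Φ = 6 ∨ cmTypeRank Φ = 7 := by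
  haveI := isPretransitive_ringEquiv_complex (K := K)
  exact typeRank_eq_six_or_seven_of_card_eq_twelve (isCMTypeWith_conj Φ) (card_embeddings_eq_twelve hK)
    ((isPrimitive_iff_forall_eq Φ.1 φ₀).1 hprim)

omit [IsCMField K] in
/-- Nondegenerate `↔ Rank = 7` in degree `12`. [cite: Dodson1987, §1.1 (p. 51)] -/
theorem isNondegenerate_iff_cmTypeRank_eq_seven (hK : Module.finrank ℚ K = 12) :
    IsNondegenerate Φ ↔ cmTypeRank Φ = 7 := by
  rw [isNondegenerate_iff, hK]

/-- **Degenerate ⟺ a balanced transversal exists** (primitive type, degree `12`): `Rank(Φ) = 6` iff there is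
`Ψ ⊆ Hom(K, ℂ)` meeting every pair `{s, s̄}` once and satisfying Pohlmann's condition (9.2.1).
[cite: Gordon1999HodgeAVSurvey, §9.2 (9.2.1) and 9.4] [cite: MoonenZarhin1999LowDim, Thm. 0.1] -/
theorem not_isNondegenerate_iff_exists_transversal (hK : Module.finrank ℚ K = 12) (φ₀ : K →+* ℂ)
    (hprim : IsPrimitive (ℂ ≃+* ℂ) Φ.1 φ₀) :
    ¬ IsNondegenerate Φ ↔ ∃ Ψ : Set (K →+* ℂ), (∀ s, s ∈ Ψ ↔ (starRingAut : ℂ ≃+* ℂ) • s ∉ Ψ) ∧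
      IsBalanced (ℂ ≃+* ℂ) Φ.1 (Ψ.indicator 1) := by
  haveI := isPretransitive_ringEquiv_complex (K := K)
  rw [isNondegenerate_iff_cmTypeRank_eq_seven hK]
  exact typeRank_ne_seven_iff_exists_transversal_of_card_eq_twelve (isCMTypeWith_conj Φ)
    (card_embeddings_eq_twelve hK) ((isPrimitive_iff_forall_eq Φ.1 φ₀).1 hprim)

/-- **Every primitive CM type on a CM field of degree `12` has corank `≤ 1`**: `[K:ℚ]/2 = 6 ≤ cmTypeRank Φ` — the
standing hypothesis `hrank` (`dim MT(A_Φ) ≥ dim A_Φ`) of every theorem of `Pohlmann1968.CorankOne`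
(`CorankOneCMTypeWeilType.lean`; on eight embeddings `CorankOne.le_cmTypeRank_of_finrank_eq_eight`).
[cite: Dodson1987, Thm. 1.0 and §1.1] [cite: Gordon1999HodgeAVSurvey, 9.4] -/
theorem le_cmTypeRank_of_finrank_eq_twelve (hK : Module.finrank ℚ K = 12) (φ₀ : K →+* ℂ)
    (hprim : IsPrimitive (ℂ ≃+* ℂ) Φ.1 φ₀) : Module.finrank ℚ K / 2 ≤ cmTypeRank Φ := by
  rw [hK]
  exact six_le_cmTypeRank hK φ₀ hprim

end Rank

/-! ### §2 Degree-`12` specialisations of `Pohlmann1968.CorankOne` (BY NAME; `hrank` discharged by §1) -/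

section WeilFibre

variable {K : Type} [Field K] [NumberField K] [IsCMField K] {Φ : CMType K}

/-- **A degenerate primitive type of a CM field of degree `12` has an exceptional balanced `6`-set**
`Δ ∈ pohlmannSets Φ 3 ∖ pohlmannDivisorSets Φ 3` (`4p = [K:ℚ] = 12`: the exceptional classes of the simple CM sixfold
live in `H⁶`). [cite: Gordon1999HodgeAVSurvey, 9.4 and 5.13 (ii)] [cite: vanGeemen1994HodgeAV, Thm. 6.12] -/
theorem exists_mem_pohlmannSets_three_diff (hK : Module.finrank ℚ K = 12) (φ₀ : K →+* ℂ)
    (hprim : IsPrimitive (ℂ ≃+* ℂ) Φ.1 φ₀) (hdeg : ¬ IsNondegenerate Φ) :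
    ∃ Δ : Finset (K →+* ℂ), Δ ∈ pohlmannSets Φ 3 \ pohlmannDivisorSets Φ 3 := by
  obtain ⟨p, Δ, hp4, hΔ⟩ := exists_mem_pohlmannSets_diff_of_not_isNondegenerate
    (le_cmTypeRank_of_finrank_eq_twelve hK φ₀ hprim) φ₀ hprim hdeg
  obtain rfl : p = 3 := by omega
  exact ⟨Δ, hΔ⟩

/-- **`Bᵠ = Dᵠ` on index sets off the middle degree**: for a primitive type of a CM field of degree `12` and `q ≠ 3`
every balanced `2q`-set is a union of conjugate pairs. [cite: vanGeemen1994HodgeAV, Thm. 6.12]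
[cite: Gordon1999HodgeAVSurvey, 5.13] -/
theorem pohlmannSets_subset_pohlmannDivisorSets_of_ne_three (hK : Module.finrank ℚ K = 12) (φ₀ : K →+* ℂ)
    (hprim : IsPrimitive (ℂ ≃+* ℂ) Φ.1 φ₀) {q : ℕ} (hq : q ≠ 3) :
    pohlmannSets Φ q ⊆ pohlmannDivisorSets Φ q :=
  pohlmannSets_subset_pohlmannDivisorSets_of_ne (le_cmTypeRank_of_finrank_eq_twelve hK φ₀ hprim) φ₀ hprim
    (by omega)

/-- **Degenerate ⟺ a Weil fibre** for a primitive type of a CM field of degree `12` (Gordon 5.13 (i) for sixfolds,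
UNCONDITIONALLY on the rank): `Φ` is degenerate iff `K` contains an (imaginary) quadratic subfield `k`, with a non-real
embedding, over which `Φ` is balanced — every embedding of `k` has as many extensions inside `Φ` as outside.
[cite: Gordon1999HodgeAVSurvey, 5.13 (i) and 9.4] [cite: MoonenZarhin1999LowDim, Thm. 0.1 (1.4)]
[cite: vanGeemen1994HodgeAV, 4.7 and 4.9] -/
theorem not_isNondegenerate_iff_exists_weilFibre (hK : Module.finrank ℚ K = 12) (φ₀ : K →+* ℂ)
    (hprim : IsPrimitive (ℂ ≃+* ℂ) Φ.1 φ₀) :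
    ¬ IsNondegenerate Φ ↔ ∃ k : IntermediateField ℚ K, Module.finrank ℚ k = 2 ∧ ∃ τ₀ : k →+* ℂ,
      ComplexEmbedding.conjugate τ₀ ≠ τ₀ ∧
        ∀ τ : k →+* ℂ, {φ : K →+* ℂ | φ.comp (algebraMap k K) = τ ∧ φ ∈ Φ.1}.ncard =
          {φ : K →+* ℂ | φ.comp (algebraMap k K) = τ ∧ φ ∉ Φ.1}.ncard := by
  rw [isNondegenerate_iff_forall_not_weilFibre (le_cmTypeRank_of_finrank_eq_twelve hK φ₀ hprim) φ₀ hprim]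
  push Not
  rfl

omit [IsCMField K] in
/-- **Balanced over a quadratic subfield in degree `12` = multiplicities `(3, 3)`**: each embedding `τ` of `k` has
`[K:k] = 6` extensions, `3` of them in `Φ`. [cite: Gordon1999HodgeAVSurvey, 5.13] [cite: vanGeemen1994HodgeAV, 4.7] -/
theorem ncard_extensions_mem_eq_three (hK : Module.finrank ℚ K = 12) {k : IntermediateField ℚ K}
    (hk : Module.finrank ℚ k = 2)
    (hbal : ∀ τ : k →+* ℂ, {φ : K →+* ℂ | φ.comp (algebraMap k K) = τ ∧ φ ∈ Φ.1}.ncard =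
      {φ : K →+* ℂ | φ.comp (algebraMap k K) = τ ∧ φ ∉ Φ.1}.ncard) (τ : k →+* ℂ) :
    {φ : K →+* ℂ | φ.comp (algebraMap k K) = τ ∧ φ ∈ Φ.1}.ncard = 3 := by
  have h6 : Module.finrank k K = 6 := by
    have hmul := Module.finrank_mul_finrank ℚ k K
    rw [hk, hK] at hmul
    omega
  have hfib := card_fibre_eq_finrank (K := K) τ
  rw [h6] at hfib
  have hsum := Finset.card_filter_add_card_filter_not
    (s := Finset.univ.filter fun φ : K →+* ℂ => φ.comp (algebraMap k K) = τ) (fun φ : K →+* ℂ => φ ∈ Φ.1)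
  rw [hfib, Finset.filter_filter, Finset.filter_filter] at hsum
  have hA : {φ : K →+* ℂ | φ.comp (algebraMap k K) = τ ∧ φ ∈ Φ.1}.ncard =
      (Finset.univ.filter fun φ : K →+* ℂ => φ.comp (algebraMap k K) = τ ∧ φ ∈ Φ.1).card := by
    rw [← Set.ncard_coe_finset]
    congr 1
    ext φ
    simp
  have hB : {φ : K →+* ℂ | φ.comp (algebraMap k K) = τ ∧ φ ∉ Φ.1}.ncard =
      (Finset.univ.filter fun φ : K →+* ℂ => φ.comp (algebraMap k K) = τ ∧ φ ∉ Φ.1).card := by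
    rw [← Set.ncard_coe_finset]
    congr 1
    ext φ
    simp
  have hτ := hbal τ
  rw [hA, hB] at hτ
  rw [hA]
  omega

/-- **`k = ℚ(√-d)`, `√-d ∈ 𝓞_K`, `Δ = {s | s(√-d) = i√d}` and `|Φ ∩ Δ| = 3`** for a degenerate primitive type of a CM
field of degree `12` (`CorankOne.exists_sqrt_neg_of_mem_pohlmannSets_diff` at `p = 3`; `|Δ| = 6 = 2·|Δ ∩ Φ|` by
balancedness at `τ = 1`). [cite: vanGeemen1994HodgeAV, 4.7 and 4.9] [cite: MoonenZarhin1999LowDim, Thm. 0.1 (1.4)]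
[cite: Gordon1999HodgeAVSurvey, §9.2 (9.2.1)] -/
theorem exists_sqrt_neg_of_not_isNondegenerate (hK : Module.finrank ℚ K = 12) (φ₀ : K →+* ℂ)
    (hprim : IsPrimitive (ℂ ≃+* ℂ) Φ.1 φ₀) (hdeg : ¬ IsNondegenerate Φ) :
    ∃ (Δ : Finset (K →+* ℂ)) (w : 𝓞 K) (d : ℕ), Δ ∈ pohlmannSets Φ 3 \ pohlmannDivisorSets Φ 3 ∧ 0 < d ∧
      w ^ 2 = -(d : 𝓞 K) ∧ (∀ s : K →+* ℂ, s ∈ Δ ↔ s (w : K) = Complex.I * (Real.sqrt d : ℂ)) ∧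
      {s : K →+* ℂ | s ∈ Φ.1 ∧ s (w : K) = Complex.I * (Real.sqrt d : ℂ)}.ncard = 3 := by
  obtain ⟨Δ, hΔ⟩ := exists_mem_pohlmannSets_three_diff hK φ₀ hprim hdeg
  obtain ⟨-, w, d, -, -, -, hd, hw2, hw⟩ :=
    exists_sqrt_neg_of_mem_pohlmannSets_diff (le_cmTypeRank_of_finrank_eq_twelve hK φ₀ hprim) φ₀ hprim hΔ
  refine ⟨Δ, w, d, hΔ, hd, hw2, hw, ?_⟩
  have h6 : Δ.card = 2 * 3 := (mem_pohlmannSets_iff.1 hΔ.1).1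
  have h2 := (mem_pohlmannSets_iff.1 hΔ.1).2.card_eq_two_mul
  have h3 : {s : K →+* ℂ | s ∈ Δ ∧ s ∈ Φ.1}.ncard = 3 := by omega
  rw [← h3]
  congr 1
  ext s
  rw [Set.mem_setOf_eq, Set.mem_setOf_eq, hw s, and_comm]

end WeilFibre

end Summit.HodgeConjecture.CorCM.CMSixfoldRank

end
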